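import Mathlib
import HarnessLib
import Literature.Computability.AlgebraicComplexity.LinSubst
import Literature.Computability.AlgebraicComplexity.OrbitClosure
import Literature.Computability.AlgebraicComplexity.OrbitCoordinateRing
import Literature.Computability.AlgebraicComplexity.MultiplicityObstructionsProofs

/-!
# The linear-substitution action on degree-`m` forms in coefficient coordinates

Bookkeeping for the rational representation of the monoid `M_σ(k)` (all square matrices, acting by
linear substitution of variables `Literature.Computability.AlgebraicComplexity.linSubst`) on the
space `V_m = k[x_σ]_m` of forms of degree `m`, written in the coordinates used by the geometric
complexity theory files (`Literature.Computability.AlgebraicComplexity.coeffVec`: a polynomial is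
the point `d ↦ coeff d f` of the big affine space `(σ →₀ ℕ) → k` of all monomials).

No new definitions are introduced; throughout, with `degMonomials σ m = Finset.univ.finsuppAntidiag m`
(file `OrbitCoordinateRing`) the finite set of monomials of degree `m`,
* the form with prescribed degree-`m` coefficients `v` is `∑ d ∈ degMonomials σ m, monomial d (v d)`;
* the action of a matrix `A` on a coefficient vector `v` is
  `coeffVec (linSubst σ k A (∑ d ∈ degMonomials σ m, monomial d (v d)))` ("`A ◇ v`" in comments);
* the pull-back of a polynomial `F` in the coefficients along `v ↦ A ◇ v` is
  `aeval (fun d ↦ ∑ d' ∈ degMonomials σ m, C (coeff d (linSubst σ k A (monomial d' 1))) * X d') F`.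

We prove: the action is a monoid action compatible with `linSubst` on forms (`act_mul`,
`act_coeffVec`), scalar matrices act by `c ^ m` (`act_smul`), the matrix coefficients and the
pull-back are polynomial in the entries of `A` (generic matrix `Matrix.mvPolynomialX`,
`eval_genericCoeff`, `eval_aeval_genericCoeff`, `eval_coeff_genericPullback`), and the pull-back
preserves homogeneity and has support in the degree-`m` variables (`isHomogeneous_pullback`,
`support_pullback_subset`). These are the formal prerequisites of the Reynolds-operator argument
in `MumfordSeparation` (Mumford–Fogarty–Kirwan, GIT, Ch. 1 §2).

References: J. M. Landsberg, *Geometry and Complexity Theory* (2017) §1.2 (the action on forms);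
H. Derksen, G. Kemper, *Computational Invariant Theory* (2002) §2.2.1 (rational representations in
coordinates). Everything here is elementary and fully proved.
-/

noncomputable section

open MvPolynomial
open Literature.Computability.AlgebraicComplexity

namespace Literature.RepresentationTheory.AlgebraicGroups

/-! ## Homogeneous scaling identities -/

section Scaling

variable {τ R : Type*} [CommSemiring R]

/-- For a homogeneous polynomial of degree `n`, every monomial in the support has degree `n`
(`Finsupp.degree` form of the definition). [folklore] -/
theorem degree_eq_of_isHomogeneous {φ : MvPolynomial τ R} {n : ℕ} (hφ : φ.IsHomogeneous n)
    {d : τ →₀ ℕ} (hd : d ∈ φ.support) : d.degree = n := by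
  rw [hφ.degree_eq_sum_deg_support hd, Finsupp.degree_apply]

/-- A homogeneous polynomial of degree `n` satisfies `φ(c • x) = cⁿ φ(x)`. [folklore] -/
theorem eval_smul_of_isHomogeneous {φ : MvPolynomial τ R} {n : ℕ} (hφ : φ.IsHomogeneous n)
    (c : R) (x : τ → R) : eval (c • x) φ = c ^ n * eval x φ := by
  classical
  conv_lhs => rw [φ.as_sum]
  conv_rhs => rw [φ.as_sum]
  rw [map_sum, map_sum, Finset.mul_sum]
  refine Finset.sum_congr rfl fun d hd => ?_
  have hdeg : d.degree = n := degree_eq_of_isHomogeneous hφ hd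
  rw [eval_monomial, eval_monomial]
  have : (d.prod fun i e => (c • x) i ^ e) = c ^ n * d.prod fun i e => x i ^ e := by
    simp only [Pi.smul_apply, smul_eq_mul, mul_pow, Finsupp.prod_mul]
    congr 1
    rw [← hdeg, Finsupp.degree_apply, Finsupp.prod, Finset.prod_pow_eq_pow_sum]
  rw [this]
  ring

/-- A homogeneous polynomial of degree `n` satisfies `φ(c • X) = cⁿ • φ` as polynomials
(substituting `c • X i` for each variable). [folklore] -/
theorem aeval_smul_X_of_isHomogeneous {φ : MvPolynomial τ R} {n : ℕ} (hφ : φ.IsHomogeneous n)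
    (c : R) : aeval (fun i => c • (X i : MvPolynomial τ R)) φ = c ^ n • φ := by
  classical
  conv_lhs => rw [φ.as_sum]
  conv_rhs => rw [φ.as_sum]
  rw [map_sum, Finset.smul_sum]
  refine Finset.sum_congr rfl fun d hd => ?_
  have hdeg : d.degree = n := degree_eq_of_isHomogeneous hφ hd
  rw [aeval_monomial, algebraMap_eq]
  have : (d.prod fun i e => (c • (X i : MvPolynomial τ R)) ^ e) =
      C (c ^ n) * d.prod fun i e => (X i : MvPolynomial τ R) ^ e := by
    simp only [smul_eq_C_mul, mul_pow, Finsupp.prod_mul, ← map_pow]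
    congr 1
    rw [← map_finsuppProd]
    congr 1
    rw [← hdeg, Finsupp.degree_apply, Finsupp.prod, Finset.prod_pow_eq_pow_sum]
  rw [this, smul_eq_C_mul, monomial_eq]
  ring

end Scaling

/-! ## The degree-`m` monomials and forms with prescribed coefficients -/

section Forms

variable {σ : Type*} [Fintype σ] [DecidableEq σ] (m : ℕ) {k : Type*} [Field k]


/-- The form `∑_{d ∈ degMonomials σ m} v_d x^d` with prescribed degree-`m` coefficients is homogeneous of
degree `m`. [folklore] -/
theorem isHomogeneous_formOfCoeffs (v : (σ →₀ ℕ) → k) :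
    (∑ d ∈ degMonomials σ m, monomial d (v d) : MvPolynomial σ k).IsHomogeneous m := by
  refine IsHomogeneous.sum _ _ _ fun d hd => ?_
  exact isHomogeneous_monomial _ (mem_degMonomials_iff.1 hd)

/-- Coefficients of the form with prescribed degree-`m` coefficients. [folklore] -/
theorem coeff_formOfCoeffs (v : (σ →₀ ℕ) → k) (d : σ →₀ ℕ) :
    coeff d (∑ d' ∈ degMonomials σ m, monomial d' (v d') : MvPolynomial σ k) = if d ∈ degMonomials σ m then v d else 0 := by
  simp only [coeff_sum, coeff_monomial]
  rw [Finset.sum_ite_eq']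

/-- A form of degree `m` is the form with its own degree-`m` coefficients. [folklore] -/
theorem formOfCoeffs_coeffVec {f : MvPolynomial σ k} (hf : f.IsHomogeneous m) :
    (∑ d ∈ degMonomials σ m, monomial d (coeffVec f d) : MvPolynomial σ k) = f := by
  ext d
  rw [coeff_formOfCoeffs]
  split_ifs with hd
  · rfl
  · exact (hf.coeff_eq_zero (mt mem_degMonomials_iff.2 hd)).symm

/-- The coefficient vector of the form with prescribed coefficients `v` is `v` on the degree-`m`
monomials. [folklore] -/
theorem coeffVec_formOfCoeffs_apply (v : (σ →₀ ℕ) → k) {d : σ →₀ ℕ} (hd : d ∈ degMonomials σ m) :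
    coeffVec (∑ d' ∈ degMonomials σ m, monomial d' (v d') : MvPolynomial σ k) d = v d := by
  rw [coeffVec_apply, coeff_formOfCoeffs, if_pos hd]

/-! ## The action `A ◇ v = coeffVec (linSubst A (form v))` -/

/-- Linear substitution by a scalar multiple: on forms of degree `m`, `(c • A) · p = c ^ m • (A · p)`.
[folklore] -/
theorem linSubst_smul_of_isHomogeneous (c : k) (A : Matrix σ σ k) {p : MvPolynomial σ k}
    (hp : p.IsHomogeneous m) : linSubst σ k (c • A) p = c ^ m • linSubst σ k A p := by
  have h1 : linSubst σ k (c • (1 : Matrix σ σ k)) p = c ^ m • p := by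
    have : linSubst σ k (c • (1 : Matrix σ σ k)) =
        aeval (fun i => c • (X i : MvPolynomial σ k)) := by
      apply MvPolynomial.algHom_ext
      intro i
      rw [linSubst_X, aeval_X]
      simp only [Matrix.smul_apply, Matrix.one_apply, smul_eq_mul, mul_ite, mul_one, mul_zero,
        ite_smul, zero_smul, Finset.sum_ite_eq', Finset.mem_univ, if_true]
    rw [this]
    exact aeval_smul_X_of_isHomogeneous hp c
  have hA : c • A = A * (c • (1 : Matrix σ σ k)) := by rw [Matrix.mul_smul, mul_one]
  rw [hA, linSubst_mul, AlgHom.comp_apply, h1, map_smul]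

/-- The coordinates of `A ◇ v`: `(A ◇ v)_d = ∑_{d' ∈ degMonomials σ m} v_{d'} · coeff_d (A · x^{d'})` — linear in `v`,
with matrix coefficients `coeff d (linSubst A (monomial d' 1))`. [folklore] -/
theorem act_apply (A : Matrix σ σ k) (v : (σ →₀ ℕ) → k) (d : σ →₀ ℕ) :
    coeffVec (linSubst σ k A (∑ d' ∈ degMonomials σ m, monomial d' (v d'))) d =
      ∑ d' ∈ degMonomials σ m, v d' * coeff d (linSubst σ k A (monomial d' 1)) := by
  rw [coeffVec_apply, map_sum, coeff_sum]
  refine Finset.sum_congr rfl fun d' _ => ?_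
  rw [show monomial d' (v d') = v d' • (monomial d' (1 : k) : MvPolynomial σ k) by
    rw [smul_monomial, smul_eq_mul, mul_one], map_smul, coeff_smul, smul_eq_mul]

/-- On an honest form `f` of degree `m` the action on coefficient vectors is the linear
substitution: `A ◇ coeffVec f = coeffVec (A · f)`. [folklore] -/
theorem act_coeffVec (A : Matrix σ σ k) {f : MvPolynomial σ k} (hf : f.IsHomogeneous m) :
    coeffVec (linSubst σ k A (∑ d ∈ degMonomials σ m, monomial d (coeffVec f d))) =
      coeffVec (linSubst σ k A f) := by
  rw [formOfCoeffs_coeffVec m hf]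

/-- The action is a (covariant) monoid action: `(A * B) ◇ v = A ◇ (B ◇ v)` (from
`linSubst_mul`). [folklore] -/
theorem act_mul (A B : Matrix σ σ k) (v : (σ →₀ ℕ) → k) :
    coeffVec (linSubst σ k (A * B) (∑ d ∈ degMonomials σ m, monomial d (v d))) =
      coeffVec (linSubst σ k A (∑ d ∈ degMonomials σ m, monomial d
        (coeffVec (linSubst σ k B (∑ d' ∈ degMonomials σ m, monomial d' (v d'))) d))) := by
  rw [act_coeffVec m A (linSubst_isHomogeneous B (isHomogeneous_formOfCoeffs m v)),
    linSubst_mul, AlgHom.comp_apply]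

/-- The identity matrix acts as the projection onto the degree-`m` coordinates; in particular it
fixes coefficient vectors of forms of degree `m`. [folklore] -/
theorem act_one_coeffVec {f : MvPolynomial σ k} (hf : f.IsHomogeneous m) :
    coeffVec (linSubst σ k (1 : Matrix σ σ k) (∑ d ∈ degMonomials σ m, monomial d (coeffVec f d))) =
      coeffVec f := by
  rw [formOfCoeffs_coeffVec m hf, linSubst_one, AlgHom.id_apply]

/-- Scalar multiples act by `c ^ m`: `(c • A) ◇ v = c ^ m • (A ◇ v)`. [folklore] -/
theorem act_smul (c : k) (A : Matrix σ σ k) (v : (σ →₀ ℕ) → k) :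
    coeffVec (linSubst σ k (c • A) (∑ d ∈ degMonomials σ m, monomial d (v d))) =
      c ^ m • coeffVec (linSubst σ k A (∑ d ∈ degMonomials σ m, monomial d (v d))) := by
  rw [linSubst_smul_of_isHomogeneous m c A (isHomogeneous_formOfCoeffs m v)]
  funext d
  simp [coeffVec_apply]

/-! ## Pull-back of polynomials in the coefficients along `v ↦ A ◇ v` -/

/-- Pointwise meaning of the pull-back: evaluating
`aeval (d ↦ ∑_{d'} C (coeff d (A · x^{d'})) * X d') F` at `v` is evaluating `F` at `A ◇ v`. [folklore] -/
theorem aeval_pullback (F : MvPolynomial (σ →₀ ℕ) k) (A : Matrix σ σ k) (v : (σ →₀ ℕ) → k) :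
    aeval v (aeval (fun d : σ →₀ ℕ => ∑ d' ∈ degMonomials σ m,
        C (coeff d (linSubst σ k A (monomial d' 1))) * X d') F) =
      aeval (coeffVec (linSubst σ k A (∑ d ∈ degMonomials σ m, monomial d (v d)))) F := by
  set h := (fun d : σ →₀ ℕ => ∑ d' ∈ degMonomials σ m,
    C (coeff d (linSubst σ k A (monomial d' 1))) * (X d' : MvPolynomial (σ →₀ ℕ) k)) with hh
  rw [aeval_eq_bind₁ h, aeval_bind₁]
  have hfun : (fun d => aeval v (h d)) =
      coeffVec (linSubst σ k A (∑ d ∈ degMonomials σ m, monomial d (v d))) := by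
    funext d
    rw [act_apply, hh]
    simp only [map_sum, map_mul, aeval_C, aeval_X, Algebra.algebraMap_self_apply]
    exact Finset.sum_congr rfl fun _ _ => mul_comm _ _
  rw [hfun]

/-- The pull-back of a homogeneous polynomial of degree `j` is homogeneous of degree `j`
(each variable is replaced by a linear form). [folklore] -/
theorem isHomogeneous_pullback {F : MvPolynomial (σ →₀ ℕ) k} {j : ℕ} (hF : F.IsHomogeneous j)
    (A : Matrix σ σ k) :
    (aeval (fun d : σ →₀ ℕ => ∑ d' ∈ degMonomials σ m,
        C (coeff d (linSubst σ k A (monomial d' 1))) * X d') F).IsHomogeneous j := by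
  have h1 : ∀ d : σ →₀ ℕ, (∑ d' ∈ degMonomials σ m, C (coeff d (linSubst σ k A (monomial d' 1))) * X d' :
      MvPolynomial (σ →₀ ℕ) k).IsHomogeneous 1 := fun d =>
    IsHomogeneous.sum _ _ _ fun d' _ => by
      simpa using (isHomogeneous_C _ _).mul (isHomogeneous_X k d')
  simpa using hF.aeval _ h1

/-- The pull-back only involves the degree-`m` variables: its support consists of monomials
`α` supported in `degMonomials σ m`, of degree `j` if `F` is homogeneous of degree `j`. [folklore] -/
theorem support_pullback_subset {F : MvPolynomial (σ →₀ ℕ) k} {j : ℕ} (hF : F.IsHomogeneous j)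
    (A : Matrix σ σ k) :
    (aeval (fun d : σ →₀ ℕ => ∑ d' ∈ degMonomials σ m,
        C (coeff d (linSubst σ k A (monomial d' 1))) * X d') F).support ⊆
      (degMonomials σ m).finsuppAntidiag j := by
  intro α hα
  rw [Finset.mem_finsuppAntidiag]
  have hsupp : α.support ⊆ degMonomials σ m := by
    intro d hd
    have hvars : d ∈ (aeval (fun d : σ →₀ ℕ => ∑ d' ∈ degMonomials σ m,
        C (coeff d (linSubst σ k A (monomial d' 1))) * X d') F).vars :=
      (mem_vars_iff_mem_support d).2 ⟨α, hα, hd⟩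
    rw [aeval_eq_bind₁] at hvars
    have := vars_bind₁ _ _ hvars
    rw [Finset.mem_biUnion] at this
    obtain ⟨i, -, hi⟩ := this
    have hsub : (∑ d' ∈ degMonomials σ m, C (coeff i (linSubst σ k A (monomial d' 1))) * X d' :
        MvPolynomial (σ →₀ ℕ) k).vars ⊆ degMonomials σ m := by
      refine (vars_sum_subset _ _).trans (Finset.biUnion_subset.2 fun d' hd' => ?_)
      refine (vars_mul _ _).trans (Finset.union_subset ?_ ?_)
      · simp [vars_C]
      · intro x hx
        rw [vars_X] at hx
        rw [Finset.mem_singleton.1 hx]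
        exact hd'
    exact hsub hi
  refine ⟨?_, hsupp⟩
  have hdeg : α.degree = j := degree_eq_of_isHomogeneous (isHomogeneous_pullback m hF A) hα
  rw [← hdeg, Finsupp.degree_apply]
  exact (Finset.sum_subset hsupp fun x _ hx => Finsupp.notMem_support_iff.1 hx).symm

end Forms

/-! ## Polynomiality in the matrix entries (generic matrix) -/

section Generic

variable {σ : Type*} [Fintype σ] [DecidableEq σ] (m : ℕ) {k : Type*} [Field k]


/-- The matrix coefficients `coeff d (A · x^{d'})` of the action on forms are polynomials in the
entries of `A`: they are the evaluations at `A` of the corresponding coefficients for the generic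
matrix `Matrix.mvPolynomialX`. [folklore] -/
theorem eval_genericCoeff (A : Matrix σ σ k) (d d' : σ →₀ ℕ) :
    eval (fun p : σ × σ => A p.1 p.2) (coeff d (linSubst σ (MvPolynomial (σ × σ) k)
      (Matrix.mvPolynomialX σ σ k) (monomial d' 1))) =
    coeff d (linSubst σ k A (monomial d' 1)) := by
  rw [← coeff_map, map_linSubst, map_monomial, map_one, ← RingHom.mapMatrix_apply,
    Matrix.mvPolynomialX_mapMatrix_eval]

/-- For fixed `G` and `v`, the function `A ↦ G(A ◇ v)` is a polynomial in the entries of `A`,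
namely the evaluation at `A` of `aeval (d ↦ ∑_{d'} v_{d'} • (generic coefficient)) G`. [folklore] -/
theorem eval_aeval_genericCoeff (G : MvPolynomial (σ →₀ ℕ) k) (A : Matrix σ σ k)
    (v : (σ →₀ ℕ) → k) :
    eval (fun p : σ × σ => A p.1 p.2)
      (aeval (fun d : σ →₀ ℕ => ∑ d' ∈ degMonomials σ m, v d' • coeff d (linSubst σ (MvPolynomial (σ × σ) k)
        (Matrix.mvPolynomialX σ σ k) (monomial d' 1))) G) =
    aeval (coeffVec (linSubst σ k A (∑ d ∈ degMonomials σ m, monomial d (v d)))) G := by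
  have hc : (eval fun p : σ × σ => A p.1 p.2).comp (algebraMap k (MvPolynomial (σ × σ) k)) =
      RingHom.id k :=
    eval₂Hom_comp_C _ _
  rw [map_aeval, hc]
  have hfun : (fun d : σ →₀ ℕ => eval (fun p : σ × σ => A p.1 p.2)
      (∑ d' ∈ degMonomials σ m, v d' • coeff d (linSubst σ (MvPolynomial (σ × σ) k)
        (Matrix.mvPolynomialX σ σ k) (monomial d' 1)))) =
      coeffVec (linSubst σ k A (∑ d ∈ degMonomials σ m, monomial d (v d))) := by
    funext d
    rw [act_apply]
    simp only [map_sum, smul_eval, eval_genericCoeff]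
  exact congrArg (fun f => eval f G) hfun

/-- The coefficients of the pull-back `F ∘ (A ◇ ·)` are polynomials in the entries of `A`: they
are the evaluations at `A` of the coefficients of the generic pull-back (computed over the
coefficient ring `k[Z]`, `Z` the generic matrix). Used for continuity in Haar averaging. [folklore] -/
theorem eval_coeff_genericPullback (F : MvPolynomial (σ →₀ ℕ) k) (A : Matrix σ σ k)
    (α : (σ →₀ ℕ) →₀ ℕ) :
    eval (fun p : σ × σ => A p.1 p.2) (coeff α
      (bind₁ (fun d : σ →₀ ℕ => ∑ d' ∈ degMonomials σ m, C (coeff d (linSubst σ (MvPolynomial (σ × σ) k)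
          (Matrix.mvPolynomialX σ σ k) (monomial d' 1))) * X d')
        (map (C : k →+* MvPolynomial (σ × σ) k) F))) =
    coeff α (aeval (fun d : σ →₀ ℕ => ∑ d' ∈ degMonomials σ m,
      C (coeff d (linSubst σ k A (monomial d' 1))) * X d') F) := by
  have hc : (eval fun p : σ × σ => A p.1 p.2).comp (C : k →+* MvPolynomial (σ × σ) k) =
      RingHom.id k :=
    eval₂Hom_comp_C _ _
  rw [← coeff_map, map_bind₁, map_map, hc, map_id, aeval_eq_bind₁]
  have hfun : (fun d : σ →₀ ℕ => map (eval fun p : σ × σ => A p.1 p.2)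
      (∑ d' ∈ degMonomials σ m, C (coeff d (linSubst σ (MvPolynomial (σ × σ) k)
          (Matrix.mvPolynomialX σ σ k) (monomial d' 1))) * X d')) =
      fun d => ∑ d' ∈ degMonomials σ m, C (coeff d (linSubst σ k A (monomial d' 1))) * X d' := by
    funext d
    simp only [map_sum, map_mul, map_C, map_X, eval_genericCoeff]
  exact congrArg (fun g => coeff α (bind₁ g F)) hfun

end Generic

end Literature.RepresentationTheory.AlgebraicGroups

end
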